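import Summits.ValiantsHypothesis.ValiantsHypothesis.Theorems.LacunarySymmetroidMatrixDescartesCensusTropicalKLawSlopes
import Summits.ValiantsHypothesis.ValiantsHypothesis.Theorems.LacunarySymmetroidMatrixDescartesCensusTropicalKLawBridges
import Summits.ValiantsHypothesis.ValiantsHypothesis.Theorems.LacunarySymmetroidMatrixDescartesCensusFrame

/-!
# Route «KPlusLogSqLaw», crux `Lifting` — WHERE THE FAT STUB SITS: it is Conjecture B on fat formats, modulo fat TB

HONEST FRAMING.  Helper file for the crux `Summit.ValiantsHypothesis.ValiantsHypothesis.Theses.KPlusLogSqLaw.Lifting`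
(ledger item `stmt-ValiantsHypothesis-19772`, route `KPlusLogSqLaw`, object-search cell `pub-symmetroid`, seat
val-sym-lift-p2, 2026-08-26).  Bookkeeping IMPLICATIONS between regime-restricted forms of the cell's open statements;
nothing here asserts `Lifting`, `TropicalB`, `KPlusLogSqLaw`, `MatrixDescartes` or anything about `VP ≠ VNP`.

The registered regime stubs of the two cruxes, written over the tree rows (`TropRow ≡ TropRootLawAt` by `Iff.rfl`,
`L = Nat.log 2 m`):
* `LiftFat  := ∃ C, ∀ m K n, L² ≤ K → TropRootLawAt m K n → RealRootLawAt m K (2^(C·K)·(n+1))`   (= `stub_liftFat`),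
* `TropFat  := ∃ C, ∀ m K,   L² ≤ K → TropRootLawAt m K (2^(C·K))`                                 (= `stub_tropFat`),
* `RealFat  := ∃ C, ∀ m K,   L² ≤ K → RealRootLawAt m K (2^(C·K))`      — Conjecture B (`KPlusLogSqLaw`) on fat formats.
These are spelled out inline below (no new `def`), and the file proves:
* `liftFat_of_realFat`            — `RealFat → LiftFat` WITHOUT using the tropical hypothesis (it is idle);
* `realFat_of_liftFat_of_tropFat` — `LiftFat → TropFat → RealFat` (`C = C_L + C_T + 1`);
* `realFat_iff_kPlusLogSq_fat`    — `RealFat ↔ ∃ C, ∀ m K, L² ≤ K → RealRootLawAt m K (2^(C·(K+L²)))` (on fat formats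
  `K ≤ K + L² ≤ 2K`), i.e. `RealFat` is literally the fat half of `KPlusLogSqLaw`;
* `kPlusLogSqLaw_iff_thin_and_fat` — `KPlusLogSqLaw ↔ (thin half) ∧ (fat half)`.
READING (located, for the planner's «mechanism split» note in the route text): modulo the tropical fat stub, the lifting
fat stub IS Conjecture B on fat formats; a proof of `stub_liftFat` that is not a proof of `RealFat` must use the tropical
hypothesis `n` where `n < 2^(O(K))`, i.e. must be a genuine pencil-to-design lifting argument — the Descartes zone
(`…LiftingDescartesZone`, cones `m ≤ c·K`) is the part where no such argument is needed.
-/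

set_option linter.dupNamespace false
set_option autoImplicit false

namespace Summit.ValiantsHypothesis.ValiantsHypothesis.Theorems.KPlusLogSqLaw

open Summit.ValiantsHypothesis.ValiantsHypothesis.Theorems.LacunarySymmetroidMatrixDescartes (RealRootLawAt KPlusLogSqLaw)
open Summit.ValiantsHypothesis.ValiantsHypothesis.Theorems.LacunarySymmetroidMatrixDescartes.TropicalCensus (TropRootLawAt)

/-- **`RealFat → LiftFat`, tropical hypothesis idle.**  If Conjecture B holds on fat formats (`log₂² m ≤ K ⇒ ζ(m,K) ≤ 2^(CK)`)
then the fat lifting stub holds with the same constant, for every tropical bound `n`. [folklore] -/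
theorem liftFat_of_realFat
    (h : ∃ C : ℕ, ∀ m K : ℕ, Nat.log 2 m ^ 2 ≤ K → RealRootLawAt m K (2 ^ (C * K))) :
    ∃ C : ℕ, ∀ m K n : ℕ, Nat.log 2 m ^ 2 ≤ K → TropRootLawAt m K n → RealRootLawAt m K (2 ^ (C * K) * (n + 1)) := by
  obtain ⟨C, hC⟩ := h
  refine ⟨C, fun m K n hK _ => ?_⟩
  exact LacunarySymmetroidMatrixDescartes.Census.realRootLawAt_mono (Nat.le_mul_of_pos_right _ (Nat.succ_pos n))
    (hC m K hK)

/-- **`LiftFat → TropFat → RealFat`** (`C = C_L + C_T + 1`): given the tropical fat stub, the lifting fat stub gives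
Conjecture B on fat formats. [folklore] -/
theorem realFat_of_liftFat_of_tropFat
    (hL : ∃ C : ℕ, ∀ m K n : ℕ, Nat.log 2 m ^ 2 ≤ K → TropRootLawAt m K n → RealRootLawAt m K (2 ^ (C * K) * (n + 1)))
    (hT : ∃ C : ℕ, ∀ m K : ℕ, Nat.log 2 m ^ 2 ≤ K → TropRootLawAt m K (2 ^ (C * K))) :
    ∃ C : ℕ, ∀ m K : ℕ, Nat.log 2 m ^ 2 ≤ K → RealRootLawAt m K (2 ^ (C * K)) := by
  obtain ⟨CL, hL⟩ := hL
  obtain ⟨CT, hT⟩ := hT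
  refine ⟨CL + CT + 1, fun m K hK => ?_⟩
  rcases Nat.eq_zero_or_pos K with hK0 | hK0
  · subst hK0
    exact LacunarySymmetroidMatrixDescartes.TropicalCensus.realRootLawAt_zero m _
  have h1 := hL m K (2 ^ (CT * K)) hK (hT m K hK)
  refine LacunarySymmetroidMatrixDescartes.Census.realRootLawAt_mono ?_ h1
  have e1 : 2 ^ (CT * K) + 1 ≤ 2 ^ (CT * K + 1) := Nat.pow_lt_pow_right (by norm_num) (Nat.lt_succ_self _)
  calc 2 ^ (CL * K) * (2 ^ (CT * K) + 1) ≤ 2 ^ (CL * K) * 2 ^ (CT * K + 1) := Nat.mul_le_mul_left _ e1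
    _ = 2 ^ (CL * K + (CT * K + 1)) := (pow_add _ _ _).symm
    _ ≤ 2 ^ ((CL + CT + 1) * K) := Nat.pow_le_pow_right (by norm_num) (by nlinarith)

/-- on fat formats the budgets `2^(C·K)` and `2^(C·(K + log₂² m))` are interchangeable (`K ≤ K + L² ≤ 2K`):
`RealFat` is literally the fat half of `KPlusLogSqLaw`. [folklore] -/
theorem realFat_iff_kPlusLogSq_fat :
    (∃ C : ℕ, ∀ m K : ℕ, Nat.log 2 m ^ 2 ≤ K → RealRootLawAt m K (2 ^ (C * K))) ↔
    (∃ C : ℕ, ∀ m K : ℕ, Nat.log 2 m ^ 2 ≤ K → RealRootLawAt m K (2 ^ (C * (K + Nat.log 2 m ^ 2)))) := by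
  constructor
  · rintro ⟨C, hC⟩
    refine ⟨C, fun m K hK => LacunarySymmetroidMatrixDescartes.Census.realRootLawAt_mono ?_ (hC m K hK)⟩
    exact Nat.pow_le_pow_right (by norm_num) (Nat.mul_le_mul_left _ (Nat.le_add_right _ _))
  · rintro ⟨C, hC⟩
    refine ⟨2 * C, fun m K hK => LacunarySymmetroidMatrixDescartes.Census.realRootLawAt_mono ?_ (hC m K hK)⟩
    exact Nat.pow_le_pow_right (by norm_num) (by nlinarith)

/-- the same interchange on the tropical side: `TropFat` is literally the fat half of `TropKPlusLogSqLaw`. [folklore] -/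
theorem tropFat_iff_tropKPlusLogSq_fat :
    (∃ C : ℕ, ∀ m K : ℕ, Nat.log 2 m ^ 2 ≤ K → TropRootLawAt m K (2 ^ (C * K))) ↔
    (∃ C : ℕ, ∀ m K : ℕ, Nat.log 2 m ^ 2 ≤ K → TropRootLawAt m K (2 ^ (C * (K + Nat.log 2 m ^ 2)))) := by
  constructor
  · rintro ⟨C, hC⟩
    refine ⟨C, fun m K hK =>
      LacunarySymmetroidMatrixDescartes.TropicalCensus.tropRootLawAt_mono ?_ (hC m K hK)⟩
    exact Nat.pow_le_pow_right (by norm_num) (Nat.mul_le_mul_left _ (Nat.le_add_right _ _))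
  · rintro ⟨C, hC⟩
    refine ⟨2 * C, fun m K hK =>
      LacunarySymmetroidMatrixDescartes.TropicalCensus.tropRootLawAt_mono ?_ (hC m K hK)⟩
    exact Nat.pow_le_pow_right (by norm_num) (by nlinarith)

/-- **B splits by regime**: `KPlusLogSqLaw ↔ (thin half: K ≤ log₂² m) ∧ (fat half: log₂² m ≤ K)`, with `C = C₁ + C₂`
in the backward direction. [folklore] -/
theorem kPlusLogSqLaw_iff_thin_and_fat :
    KPlusLogSqLaw ↔
      (∃ C : ℕ, ∀ m K : ℕ, K ≤ Nat.log 2 m ^ 2 → RealRootLawAt m K (2 ^ (C * (K + Nat.log 2 m ^ 2)))) ∧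
      (∃ C : ℕ, ∀ m K : ℕ, Nat.log 2 m ^ 2 ≤ K → RealRootLawAt m K (2 ^ (C * (K + Nat.log 2 m ^ 2)))) := by
  constructor
  · rintro ⟨C, hC⟩
    exact ⟨⟨C, fun m K _ => hC m K⟩, ⟨C, fun m K _ => hC m K⟩⟩
  · rintro ⟨⟨C₁, h₁⟩, ⟨C₂, h₂⟩⟩
    refine ⟨C₁ + C₂, fun m K => ?_⟩
    rcases le_total K (Nat.log 2 m ^ 2) with hK | hK
    · refine LacunarySymmetroidMatrixDescartes.Census.realRootLawAt_mono ?_ (h₁ m K hK)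
      exact Nat.pow_le_pow_right (by norm_num) (Nat.mul_le_mul_right _ (Nat.le_add_right _ _))
    · refine LacunarySymmetroidMatrixDescartes.Census.realRootLawAt_mono ?_ (h₂ m K hK)
      exact Nat.pow_le_pow_right (by norm_num) (Nat.mul_le_mul_right _ (Nat.le_add_left _ _))

/-- **The fat half of B from the two fat stubs** (composition of the above): `LiftFat → TropFat →` fat half of
`KPlusLogSqLaw`. [folklore] -/
theorem kPlusLogSq_fat_of_stubs
    (hL : ∃ C : ℕ, ∀ m K n : ℕ, Nat.log 2 m ^ 2 ≤ K → TropRootLawAt m K n → RealRootLawAt m K (2 ^ (C * K) * (n + 1)))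
    (hT : ∃ C : ℕ, ∀ m K : ℕ, Nat.log 2 m ^ 2 ≤ K → TropRootLawAt m K (2 ^ (C * K))) :
    ∃ C : ℕ, ∀ m K : ℕ, Nat.log 2 m ^ 2 ≤ K → RealRootLawAt m K (2 ^ (C * (K + Nat.log 2 m ^ 2))) :=
  realFat_iff_kPlusLogSq_fat.mp (realFat_of_liftFat_of_tropFat hL hT)

end Summit.ValiantsHypothesis.ValiantsHypothesis.Theorems.KPlusLogSqLaw
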